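import Summits.Ventures.HodgeKum4.Theorems.KummerFixedLocusLefschetzGenerationKum4
import Summits.Ventures.HodgeKum4.Theorems.KummerFixedLocusInvariantComplement
import HarnessLib

/-!
# Route KummerFixedLocus (`hodge-kum4`, rung H3) — L1: discharge of the frame-complement hypothesis

Seat p1.  `FrameComplementKum4` (the kernel-derivable hypothesis of the L1 closer
`lefschetzGenerationKum4_of_model`, file `KummerFixedLocusLefschetzGenerationKum4`) is PROVED here from
the two REFEREED print facts already used by seat p2: `Floccari2026_card_autFixingH2H3_kum4Type`
(`|Γ(X)| = 625`) and `Foster2024_translationAction_kum4Type` (Γ acts trivially off degree `8`; `H²`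
multiplies the coinvariant kernel to zero):

* `IsKummerTranslationFrame.toAut_injective`, `….toAut_surjective` — a Kummer translation frame
  `(ℤ/5)⁴ → Γ(X)` is a bijection onto `Γ(X)` when `|Γ(X)| = 625`;
* `frameInvariants_eq_gammaInvariantClasses` — hence `H*(X(ℂ); ℂ)^{frame} = H*(X(ℂ); ℂ)^{Γ(X)}`;
* **`frameComplementKum4_of_literature`** — `N' := 𝒦_tot` (seat p2's `coinvariantsKerTotal`) is a
  complement (p2's `isCompl_gammaInvariantClasses_coinvariantsKerTotal_of_literature`) killed by `h`
  (`degreeOperator_apply_of_mem`) and by every `L_x` (`totalLefschetz_apply_of_mem`, Foster);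
* **`lefschetzGenerationKum4_of_model_of_literature`** — the L1 closer with ONLY MODEL_X
  (`KummerOrbifoldModelKum4`) and refereed print as hypotheses:
  MODEL_X → LLV structure → `|Γ| = 625` → Foster → frame existence → `LefschetzGenerationKum4`.
-/

noncomputable section

open CategoryTheory
open Literature.AlgebraicTopology.SingularHomology
open Literature.AlgebraicGeometry Literature.AlgebraicGeometry.HodgeTheory
open Literature.AlgebraicGeometry.Hyperkaehler (IsOfGeneralizedKummerType totalCohomology ofDegree
  degreeOperator totalLefschetz invariantClasses mem_invariantClasses_iff
  LooijengaLuntsVerbitsky_llvStructure_kumType Floccari2026_card_autFixingH2H3_kum4Type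
  Foster2024_translationAction_kum4Type)

namespace Summit.Ventures.HodgeKum4

variable {X : Motives.SchemeOver ℂ} {g : (Fin 4 → ZMod 5) → (X ⟶ X)}

/-- A Kummer translation frame is injective on automorphisms (faithfulness). -/
theorem IsKummerTranslationFrame.toAut_injective (hg : IsKummerTranslationFrame X g) :
    Function.Injective fun a ↦ (⟨hg.toAut a, hg.toAut_mem a⟩ : autFixingH2H3 X) := by
  intro a b hab
  have h1 : g a = g b := by
    have := congrArg (fun γ : autFixingH2H3 X ↦ γ.val.hom) hab
    exact this
  by_contra hne
  have hne' : a - b ≠ 0 := sub_ne_zero.mpr hne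
  apply hg.2.2.1 (a - b) hne'
  -- g (a - b) = g a ≫ g (-b) = g b ≫ g (-b) = g 0 = 𝟙
  rw [sub_eq_add_neg, hg.2.1, h1, ← hg.2.1, add_neg_cancel, hg.1]

/-- For `X` of `Kum⁴`-type (`|Γ(X)| = 625`), a Kummer translation frame EXHAUSTS `Γ(X)`. -/
theorem IsKummerTranslationFrame.toAut_surjective (h₁ : Floccari2026_card_autFixingH2H3_kum4Type)
    (hX : Motives.IsSmoothProjective 8 X) (hK : IsOfGeneralizedKummerType 4 X)
    (hg : IsKummerTranslationFrame X g) :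
    Function.Surjective fun a ↦ (⟨hg.toAut a, hg.toAut_mem a⟩ : autFixingH2H3 X) := by
  have hcard : Nat.card (autFixingH2H3 X) = 625 := h₁ hX hK
  haveI : Finite (autFixingH2H3 X) := Nat.finite_of_card_ne_zero (by rw [hcard]; norm_num)
  have hdom : Nat.card (Fin 4 → ZMod 5) = 625 := by
    rw [Nat.card_eq_fintype_card]; simp
  exact (Function.Injective.bijective_of_nat_card_le hg.toAut_injective
    (by rw [hcard, hdom])).surjective

/-- **`H*(X(ℂ); ℂ)^{frame} = H*(X(ℂ); ℂ)^{Γ(X)}`** for a Kummer translation frame on a `Kum⁴`-type `X`. -/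
theorem frameInvariants_eq_gammaInvariantClasses (h₁ : Floccari2026_card_autFixingH2H3_kum4Type)
    (hX : Motives.IsSmoothProjective 8 X) (hK : IsOfGeneralizedKummerType 4 X)
    (hg : IsKummerTranslationFrame X g) :
    frameInvariants X g = gammaInvariantClasses X := by
  apply le_antisymm
  · intro v hv
    rw [frameInvariants, mem_invariantClasses_iff] at hv
    rw [gammaInvariantClasses, mem_invariantClasses_iff]
    rintro _ ⟨γ, rfl⟩
    obtain ⟨a, rfl⟩ := hg.toAut_surjective h₁ hX hK γ
    exact hv _ ⟨a, rfl⟩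
  · intro v hv
    rw [gammaInvariantClasses, mem_invariantClasses_iff] at hv
    rw [frameInvariants, mem_invariantClasses_iff]
    rintro _ ⟨a, rfl⟩
    exact hv _ ⟨⟨hg.toAut a, hg.toAut_mem a⟩, rfl⟩

/-- **The frame complement from refereed print** (`|Γ(X)| = 625`, Foster's translation action):
`N' = 𝒦_tot`. -/
theorem frameComplementKum4_of_literature (h₁ : Floccari2026_card_autFixingH2H3_kum4Type)
    (h₂ : Foster2024_translationAction_kum4Type) : FrameComplementKum4 := by
  intro X g hX hK hg
  refine ⟨coinvariantsKerTotal X, ?_, fun n hn ↦ degreeOperator_apply_of_mem hn,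
    fun x n hn ↦ totalLefschetz_apply_of_mem h₂ hX hK x hn⟩
  rw [frameInvariants_eq_gammaInvariantClasses h₁ hX hK hg]
  exact isCompl_gammaInvariantClasses_coinvariantsKerTotal_of_literature h₁ h₂ hX hK

/-- **L1 = `LefschetzGenerationKum4` from MODEL_X and refereed print only** (kernel; item
stmt-Ventures-19134): MODEL_X → LLV structure (LL97/GKLR) → `|Γ(X)| = 625` (Floccari) → Foster's
translation action → frame existence (BNWS/HT/Oguiso) → L1. -/
theorem lefschetzGenerationKum4_of_model_of_literature (hM : KummerOrbifoldModelKum4)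
    (hF : LooijengaLuntsVerbitsky_llvStructure_kumType) (h₁ : Floccari2026_card_autFixingH2H3_kum4Type)
    (h₂ : Foster2024_translationAction_kum4Type) (hex : KummerTranslationFrameExists) :
    Summit.Ventures.HodgeKum4.LefschetzGenerationKum4 :=
  lefschetzGenerationKum4_of_model hM (frameComplementKum4_of_literature h₁ h₂) hF hex

end Summit.Ventures.HodgeKum4

end
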